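import Literature.MathematicalPhysics.QuantumFieldTheory.Federbush1986.LandauModeWeakEulerLagrange

/-!
# `Federbush1986.LandauModeBondMultipliers` — [Federbush1986PhaseCellI] §3 (3.4) «We seek a minimum of the action S … and then
# take the limit α → ∞. (Alternatively one could use Lagrange multipliers.)», (3.11) «the minimizing A′ will satisfy
# A′ = α²C Σ_γ β_γ χ_γ» — THE EULER–LAGRANGE EQUATION OF THE EXPLICIT FIELD WITH ITS LAGRANGE MULTIPLIERS: for EVERY smooth
# compactly supported variation `ψ`, `∫Σ_{μ<ν}F_{μν}(A^N)F_{μν}(ψ) = Σ_{bonds e} μ_e · A_ψ(e, 0)` with explicit bond multipliers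
# `μ_{(m,ν)} = Re (1/2π)² ∫_cell Λ_ν(p) e^{ip·m} d⁴p` forming a divergence-free lattice current

statement-level skeleton of published theorems with citation tags; proofs where landed; nothing here is a claim about the Yang–Mills mass gap

CITATION HEADER.  P. Federbush, *A phase cell approach to Yang–Mills theory. I. Modes, lattice-continuum duality*, Commun.
Math. Phys. **107** (1986) 319–329 [Federbush1986PhaseCellI] (pp. 325, 327–328 read as images `run/shared/lean/pub/lit-balaban/
lit-balaban-r17/renders/fedI/fed1986-cmp107-p007|p009|p010-x2.png`); P. Federbush, C. Williamson, *… II. Analysis of a mode*,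
J. Math. Phys. **28** (1987) 1416–1419 [FederbushWilliamson1987PhaseCellII]; E. M. Stein, G. Weiss, *Introduction to Fourier
Analysis on Euclidean Spaces* (1971) Ch. VII [SteinWeiss1971] (Poisson summation; orthogonality of characters).  Unit `lit-balaban-r17`
gen 12 (fold owner of the Federbush block; own lane `Federbush1986/`), SKELETON rows **F1.Eq3.2-3.12** (cell (3.4)/(3.11):
Lagrange multipliers), **F1.Eq3.1** / **F1.Sect§0** (consumer: `hmin` of `modeEstimatesLe_of_field_minimal`), **F1.Eq2.1-2.2**
((2.1)–(2.2) in momentum space), **F2.Eq2.1-2.5**; heads unchanged.  HOME `run/shared/lean/pub/lit-balaban/`.  Continues r17 gen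
12's `LandauModeWeakEulerLagrange` (the same identity for CONSTRAINT-PRESERVING `ψ`, where the right side is `0`).

THE PRINT (verbatim).  I p. 325: *«We associate to this bond (with an orientation in the + x_i direction) the group element
2^{3r} ∫dx_t ∫dx_s ∫dx ∫dy c(x)A_i(·), (2.1) where c(x) = 2^r(x − x_i) for (x − x_i) ≦ 2^{−r}, 2 − 2^r(x − x_i) for (x − x_i) ≧ 2^{−r}.
(2.2)»* (the tree's `bondWeight` uses the rescaled profile `c(u) = u` on `[0,1]`, `2 − u` on `[1,2]`, `u = 2^r(x − x_i)`); p. 327: *«We seek a minimum of the action S, for a Landau gauge A′, a gauge transformation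
of A. S = ½∫Σ_{i,j}(∂A′_i/∂x_j)² + ½α² Σ_{p∈ℒ⁰}((χ_p, A′) − β_p)², (3.4) and then take the limit α → ∞. (Alternatively one could
use Lagrange multipliers.)»*; p. 328: *«From (3.4) we see the minimizing A′ will satisfy A′ = α²C Σ_γ β_γχ_γ. (3.11) Taking the limit α → ∞ we find in terms of
Fourier transforms, [(3.12)]»*.  II p. 1417: *«A′_i = (−r_L f̄₁⁻¹ (1/p²))(1/p_i)(16/𝒟) l_i, (2.1) l₁ = ⟨1/p₂²⟩⟨1/p₃²⟩ + ⟨1/p₂²⟩⟨1/p₄²⟩ +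
⟨1/p₃²⟩⟨1/p₄²⟩, (2.2) l_i = −∏_{j≠1,i}⟨1/p_j²⟩, i ≠ 1. (2.3)»* (the identity `Σ_i l_i = 0` used below is OURS, read off (2.2)–(2.3)).
(v1.1 DOCFIX, r17 gen 13 quotation audit; declarations untouched: the v1 block quoted (2.2) in a rescaled form «c(x) = x for 0 ≤ x ≤ 1 …»,
(3.11) as «In the limit α → ∞ the minimizing A′ will satisfy …» — print has (3.11) at finite α, the limit giving (3.12) — and «Σ l_i …
(2.2)–(2.3)»; all three were paraphrases inside quotation marks.)

THE ARGUMENT (ours; print does not develop the multipliers).  By `LandauModeWeakEulerLagrange`, the cross term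
`∫Σ_{μ<ν}F_{μν}(A^N)F_{μν}(ψ)` equals `Re ∫ d⁴p W(p)` with `W = (1/2π)² Σ_ν Λ_ν b̂_ν Ψ_ν` a.e. (`p²A′_ν = Λ_ν b̂_ν`, Landau gauge),
`Λ_ν` `2π`-periodic and bounded.  Now `b̂_ν(p)Ψ_ν(p) = k̂_ν(p)` is the transform of the translated BOND pairing
`k_ν(y) = ∫ b_{(0,ν)}(z) ψ_ν(z + y) dz`, whose values at the lattice points are the level-0 bond variables `A_ψ((m,ν), 0)` of (2.1)
— finitely many of them non-zero.  Poisson summation in EQUALITY form gives `Σ_n k̂_ν(p + 2πn) = Σ_m A_ψ((m,ν),0) e^{ip·m}` (a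
trigonometric polynomial: both sides are continuous periodic with the same cell Fourier coefficients), so the cell decomposition
yields `Re (1/2π)² ∫_cell Σ_ν Λ_ν(p) Σ_m A_ψ((m,ν),0) e^{ip·m} = Σ_{ν,m} μ_{(m,ν)} A_ψ((m,ν), 0)`.  Finally `Σ_ν Λ_ν f_ν = 0`
(`Σ_i l_i = 0`) says that `μ` is divergence-free on `ℤ⁴`: it annihilates the bond variables of lattice gradients, i.e. it is a
functional of PLAQUETTE variables, as a multiplier for the constraint (3.3) must be.

WHAT IS PROVED (kernel-checked; `def`s with bodies; no `Prop`-valued definition, no named fact, no `sorry`).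
* §1 `bondProfile`, `indicator_boxUp_tent_eq_prod`, `integral_prod_bondProfile`, **`fourier_bondWeight_level0`**: `∫e^{−ip·z}b_{(b,ν)}(z)
  d⁴z = e^{−ip·b} b̂_ν(p)` (all `p_k ≠ 0`; the tree's `bondFactor`) — (2.1)–(2.2) in momentum space.
* §2 the translated bond pairing `bpairT`: **`bpairT_latPt`** (`k_ν(m) = approxTop 0 ψ (m,ν)`), `continuous_bpairT`,
  `hasCompactSupport_bpairT`, `bpairT_eq_zero_of_norm`; the general shear lemma **`hatE_transPair`** (`(∫K(z)ψ_ν(z+·))^ = K̂Ψ_ν`);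
  `bondHat`, `bondHat_eq_bondFactor`, **`hatE_bpairTC`** (`k̂_ν = b̂⁰_νΨ_ν`), `invSqDecay_hatE_bpairTC`.
* §3 `volume_cell_lt_top`, `integrableOn_cell_of_continuous`, `integral_Ico_cexp_int`,
  **`integral_cell_cexp_neg_mul_cexp`** (orthogonality of characters on the cell), **`perSum_hatE_eq_sum`** (POISSON SUMMATION IN
  EQUALITY FORM for finitely many non-zero lattice values), **`perSum_hatE_bpairTC_eq_sum`**.
* §4 `offLattice` (co-null, `restrict_offLattice`); `CorrectedMode.Jhat` (`Ĵ_ν = p²ĝ_ν − p_ν(p·ĝ)`), `continuous_Jhat`,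
  **`Jhat_eq`** (`Ĵ_ν = (1/2π)²Λ_νb̂_ν` off the lattice hyperplanes), `bondFactor_ne_zero`, `continuousOn_bondFactor`,
  `Lam_toC_eq_Jhat_div`, **`continuousOn_Lam_toC`**, `aestronglyMeasurable_Lam_toC`, `ae_norm_Lam_toC_le`, `integrableOn_Lam_toC_mul`,
  `integrableOn_Lam_toC_mul_cexp`; **`bondMult`** (the bond multipliers).
* §5 `Wbond`, `Wfun_eq_Wbond`, `crossIntegrand_ae_eq_Wbond`, **`tsum_Wbond_shiftR_eq`**, and
  **`integral_crossDensity_field_eq_sum_bondMult`: `∫Σ_{μ<ν}F_{μν}(A^N)F_{μν}(ψ) = Σ_ν Σ_{m∈S} μ_{(m,ν)} · approxTop 0 ψ (m,ν)`** for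
  every smooth compactly supported `ψ` and every finite `S` carrying its level-0 bond variables; `exists_finset_approxTop_eq_zero`
  (such `S` exists), `integral_crossDensity_field_eq_sum_bondMult'`.
* §6 **`sum_bondMult_sub_eq_zero`: `Σ_ν (μ_{(m,ν)} − μ_{(m−e_ν,ν)}) = 0`** at every site (divergence-free).

HONEST SCOPE.  (a) The multipliers here are indexed by BONDS (`μ = ∂σ` for plaquette multipliers `σ` is the equivalent closed-
current form; §6 is exactly `∂μ = 0`); print's plaquette multipliers `λ_i(p)`/`α²(β − (χ,A′))` are not evaluated.  (b) NOT proved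
here: any DECAY of `μ_{(m,ν)}` in `m` (only `Λ_ν ∈ L^∞`, so `μ ∈ ℓ²` at best from this file); the exponential decay (from the
analyticity of `ĝ` on a complex tube, via `Λ_ν = Σ_nĴ_ν b̂_ν^*(p+2πn)/((1/2π)²Σ_n|b̂_ν|²(p+2πn))` and a periodic contour shift) is
the next step, and with it the passage from test variations to the general `C¹` competitor of `hmin` — nothing is claimed about
either.  (c) The mode is p04's corrected-gauge mode; `Ĵ` and `W` are gauge-independent; `bondMult` does not depend on `s`.
(d) Pointwise identities are used off the null set `{∃k, p_k ∈ 2πℤ}` only; `Λ_ν∘toC` carries junk values there (irrelevant under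
the integral).  Axioms standard.
-/

namespace Literature.MathematicalPhysics.QuantumFieldTheory.Federbush1986

noncomputable section

open Complex ModeAnalyticity Filter Topology MeasureTheory Set
open scoped BigOperators ComplexConjugate FourierTransform RealInnerProductSpace ContDiff

namespace PlaquetteGram

open ModeDecay (toC phase modeFT modeField)
open PlaquetteFourier

/-! ## §1 (2.1)–(2.2) in momentum space: the transform of the level-0 bond weight is `e^{−ip·b} b̂_ν(p)` -/

/-- The one-variable profiles of the level-0 bond weight of direction `ν`: the tent `c·𝟙_{[0,2]}` along the bond, the unit
indicator `𝟙_{[0,1]}` across. [cite: Federbush1986PhaseCellI, (2.1)–(2.2) p. 325] -/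
def bondProfile (ν k : Fin 4) (y : ℝ) : ℝ :=
  if k = ν then (Icc (0 : ℝ) 2).indicator tent y else (Icc (0 : ℝ) 1).indicator 1 y

/-- The level-0 bond weight in cube coordinates is the product of its profiles. [cite: Federbush1986PhaseCellI, (2.1)–(2.2) p. 325] -/
theorem indicator_boxUp_tent_eq_prod (ν : Fin 4) (w : Fin 4 → ℝ) :
    (Icc (0 : Fin 4 → ℝ) (boxUp ν)).indicator (fun u => tent (u ν)) w = ∏ k, bondProfile ν k (w k) := by
  by_cases hw : w ∈ Icc (0 : Fin 4 → ℝ) (boxUp ν)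
  · rw [indicator_of_mem hw]
    have hk : ∀ k, w k ∈ Icc (0 : ℝ) (boxUp ν k) := fun k => ⟨hw.1 k, hw.2 k⟩
    have : ∀ k, bondProfile ν k (w k) = if k = ν then tent (w k) else 1 := fun k => by
      by_cases hkν : k = ν
      · subst hkν
        have h2 : w k ∈ Icc (0 : ℝ) 2 := by simpa [boxUp] using hk k
        simp [bondProfile, indicator_of_mem h2]
      · have h1 : w k ∈ Icc (0 : ℝ) 1 := by simpa [boxUp, hkν] using hk k
        simp [bondProfile, hkν, indicator_of_mem h1]
    simp_rw [this]
    rw [Finset.prod_ite_eq']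
    simp
  · rw [indicator_of_notMem hw]
    have : ∃ k, w k ∉ Icc (0 : ℝ) (boxUp ν k) := by
      by_contra hc
      apply hw
      constructor
      · intro k; by_contra h'; exact hc ⟨k, fun hh => h' hh.1⟩
      · intro k; by_contra h'; exact hc ⟨k, fun hh => h' hh.2⟩
    obtain ⟨k, hk⟩ := this
    symm
    refine Finset.prod_eq_zero (Finset.mem_univ k) ?_
    by_cases hkν : k = ν
    · subst hkν
      have h2 : w k ∉ Icc (0 : ℝ) 2 := by simpa [boxUp] using hk
      simp [bondProfile, indicator_of_notMem h2]
    · have h1 : w k ∉ Icc (0 : ℝ) 1 := by simpa [boxUp, hkν] using hk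
      simp [bondProfile, hkν, indicator_of_notMem h1]

/-- The factorised integral of the bond profiles: tent factor at `ν`, unit factors across.
[cite: Federbush1986PhaseCellI, (2.2) p. 325, (3.10) p. 328] -/
theorem integral_prod_bondProfile (ν : Fin 4) (p : Fin 4 → ℝ) (hp : ∀ k, p k ≠ 0) :
    ∫ w : Fin 4 → ℝ, ∏ k, ((bondProfile ν k (w k) : ℝ) : ℂ) * cexp (-I * p k * w k)
      = (-(1 - cexp (-I * p ν)) ^ 2 / (p ν : ℂ) ^ 2) * ∏ k ∈ Finset.univ.erase ν, I * (cexp (-I * p k) - 1) / p k := by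
  have hF : (∫ w : Fin 4 → ℝ, ∏ k, ((bondProfile ν k (w k) : ℝ) : ℂ) * cexp (-I * p k * w k))
      = ∏ k, ∫ y : ℝ, ((bondProfile ν k y : ℝ) : ℂ) * cexp (-I * p k * y) :=
    integral_fintype_prod_eq_prod (ι := Fin 4) (fun k (y : ℝ) => ((bondProfile ν k y : ℝ) : ℂ) * cexp (-I * p k * y))
  rw [hF, ← Finset.mul_prod_erase Finset.univ _ (Finset.mem_univ ν)]
  have hν : bondProfile ν ν = (Icc (0 : ℝ) 2).indicator tent := by funext y; simp [bondProfile]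
  rw [hν, integral_tent_phase (hp ν)]
  congr 1
  refine Finset.prod_congr rfl fun k hk => ?_
  have hkν : k ≠ ν := (Finset.mem_erase.mp hk).1
  have hk' : bondProfile ν k = (Icc (0 : ℝ) 1).indicator 1 := by funext y; simp [bondProfile, hkν]
  rw [hk']
  exact integral_unit_phase (hp k)

/-- Coordinates of the affine parametrisation of the box of the level-0 edge `(b, ν)`: `(b + w)_k`. [cite: Federbush1986PhaseCellI, (2.1) p. 325] -/
theorem edge_src_add_apply (b : Fin 4 → ℤ) (ν : Fin 4) (w : Fin 4 → ℝ) (k : Fin 4) :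
    ((⟨b, ν⟩ : Edge 0).src + latLen 0 • (mkPt w : E4)) k = (b k : ℝ) + w k := by
  simp [Edge.src, mkPt, latLen]

/-- The plane wave at the parametrised point: corner phase times a product over coordinates. [cite: Federbush1986PhaseCellI, (3.12) p. 328] -/
theorem phase_edge_affine (b : Fin 4 → ℤ) (ν : Fin 4) (p : Fin 4 → ℝ) (w : Fin 4 → ℝ) :
    cexp (-I * ∑ k, (p k : ℂ) * ((((⟨b, ν⟩ : Edge 0).src + latLen 0 • (mkPt w : E4)) k : ℝ) : ℂ))
      = cexp (-I * ∑ k, (p k : ℂ) * (b k : ℂ)) * ∏ k, cexp (-I * p k * w k) := by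
  simp only [edge_src_add_apply]
  push_cast
  have hsum : -I * ∑ k, (p k : ℂ) * ((b k : ℂ) + (w k : ℂ))
      = (-I * ∑ k, (p k : ℂ) * (b k : ℂ)) + ∑ k, (-I * p k * w k) := by
    rw [Finset.mul_sum, Finset.mul_sum, ← Finset.sum_add_distrib]
    exact Finset.sum_congr rfl fun k _ => by ring
  rw [hsum, Complex.exp_add, Complex.exp_sum]

/-- **(2.1)–(2.2) in momentum space — the Fourier transform of the level-0 bond weight**: for the edge `(b, ν) ∈ ℒ⁰` and every
real momentum with all `p_k ≠ 0`, `∫ d⁴z e^{−ip·z} b_{(b,ν)}(z) = e^{−ip·b} b̂_ν(p)` with the tree's `bondFactor`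
(`b̂_ν = ∏_{k≠ν}(i/p_k)(e^{−ip_k} − 1) · (−(1 − e^{−ip_ν})²/p_ν²)`). [cite: Federbush1986PhaseCellI, (2.1)–(2.2) p. 325, (3.10) p. 328;
FederbushWilliamson1987PhaseCellII, (1.7) p. 1416] -/
theorem fourier_bondWeight_level0 (b : Fin 4 → ℤ) (ν : Fin 4) {p : Fin 4 → ℝ} (hp : ∀ k, p k ≠ 0) :
    ∫ z : E4, cexp (-I * ∑ k, (p k : ℂ) * ((z k : ℝ) : ℂ)) * ((bondWeight (⟨b, ν⟩ : Edge 0) z : ℝ) : ℂ)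
      = cexp (-I * ∑ k, (p k : ℂ) * (b k : ℂ)) * bondFactor ν p := by
  set e : Edge 0 := ⟨b, ν⟩ with he
  rw [integral_comp_cubeAffine' 0 e.src]
  have hχ : ∀ w : Fin 4 → ℝ, bondWeight e (e.src + latLen 0 • (mkPt w : E4)) = ∏ k, bondProfile ν k (w k) := by
    intro w
    rw [bondWeight_apply, cubeCoord_affine]
    simp only [latLen, pow_zero, inv_one, one_pow, one_mul]
    exact indicator_boxUp_tent_eq_prod ν w
  have key : ∀ w : Fin 4 → ℝ,
      (∏ k, cexp (-I * p k * w k)) * (∏ k, ((bondProfile ν k (w k) : ℝ) : ℂ))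
        = ∏ k, (((bondProfile ν k (w k) : ℝ) : ℂ) * cexp (-I * p k * w k)) := by
    intro w
    rw [← Finset.prod_mul_distrib]
    exact Finset.prod_congr rfl fun k _ => mul_comm _ _
  have hpt : ∀ w : Fin 4 → ℝ,
      cexp (-I * ∑ k, (p k : ℂ) * (((e.src + latLen 0 • (mkPt w : E4)) k : ℝ) : ℂ)) *
          ((bondWeight e (e.src + latLen 0 • (mkPt w : E4)) : ℝ) : ℂ)
        = cexp (-I * ∑ k, (p k : ℂ) * (b k : ℂ)) * ∏ k, (((bondProfile ν k (w k) : ℝ) : ℂ) * cexp (-I * p k * w k)) := by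
    intro w
    rw [hχ, he, phase_edge_affine, Complex.ofReal_prod, mul_assoc, key]
  simp only [hpt]
  rw [MeasureTheory.integral_const_mul, integral_prod_bondProfile ν p hp]
  simp only [latLen, pow_zero, inv_one, one_pow, one_smul]
  unfold bondFactor
  ring

/-! ## §2 The translated bond pairing `k_ν(y) = (b_{(0,ν)}(· − y), ψ_ν)` and its transform `b̂_ν Ψ_ν` -/

variable {ψ : E4 → Fin 4 → ℝ}

/-- The level-0 bond weight of the origin edge of direction `ν` vanishes outside the ball of radius `4` (its box is `[0,1]³ × [0,2]_ν`).
[cite: Federbush1986PhaseCellI, (2.1) p. 325] -/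
theorem bondWeight_edge0_eq_zero (ν : Fin 4) {z : E4} (hz : 4 < ‖z‖) : bondWeight (⟨0, ν⟩ : Edge 0) z = 0 := by
  refine bondWeight_of_not_mem _ fun hmem => ?_
  have hsrc : (⟨0, ν⟩ : Edge 0).src = 0 := by
    rw [edge_src_zero]; simp [latPt, toE4]; rfl
  have hc : ∀ k, cubeCoord 0 (⟨0, ν⟩ : Edge 0).src z k = z k := fun k => by simp [cubeCoord_apply, hsrc, latLen]
  have hk : ∀ k, (z k) ^ 2 ≤ 4 := fun k => by
    have h1 := hmem.1 k; have h2 := hmem.2 k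
    rw [hc k] at h1 h2
    have h2' : z k ≤ 2 := h2.trans (by simp only [boxUp]; split_ifs <;> norm_num)
    simp only [Pi.zero_apply] at h1
    nlinarith
  have hn : ‖z‖ ^ 2 ≤ 16 := by
    rw [EuclideanSpace.norm_sq_eq]
    calc ∑ k, ‖z k‖ ^ 2 ≤ ∑ _k : Fin 4, (4 : ℝ) := Finset.sum_le_sum fun k _ => by rw [Real.norm_eq_abs, sq_abs]; exact hk k
      _ = 16 := by simp; norm_num
  nlinarith [norm_nonneg z]

/-- `0 ≤ b ≤ 1` at level 0. [cite: Federbush1986PhaseCellI, (2.2) p. 325] -/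
theorem abs_bondWeight_edge0_le (ν : Fin 4) (z : E4) : |bondWeight (⟨0, ν⟩ : Edge 0) z| ≤ 1 := by
  rw [abs_of_nonneg (bondWeight_nonneg _ z)]
  have h := bondWeight_le (⟨0, ν⟩ : Edge 0) z
  simpa [latLen] using h

/-- The level-0 bond weight is integrable. [cite: Federbush1986PhaseCellI, (2.1)–(2.2) p. 325] -/
theorem integrable_bondWeight (e : Edge 0) : Integrable (bondWeight e) := by
  have h := integrable_bondWeight_mul (A := fun _ _ => (1 : ℝ)) continuous_const e 0
  simpa using h

/-- **The translated bond pairing** `k_ν(y) = ∫ d⁴z b_{(0,ν)}(z) ψ_ν(z + y)`: at `y = m ∈ ℤ⁴` it is the level-0 bond variable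
`A(e, 0)` of (2.1) for the edge `e = (m, ν)`. [cite: Federbush1986PhaseCellI, (2.1)–(2.2) p. 325, (3.4) p. 327] -/
def bpairT (ψ : E4 → Fin 4 → ℝ) (ν : Fin 4) (y : E4) : ℝ := ∫ z, bondWeight (⟨0, ν⟩ : Edge 0) z * ψ (z + y) ν

/-- The translated bond pairing as a complex function. [cite: Federbush1986PhaseCellI, (2.1) p. 325] -/
def bpairTC (ψ : E4 → Fin 4 → ℝ) (ν : Fin 4) : E4 → ℂ := fun y => ((bpairT ψ ν y : ℝ) : ℂ)

/-- **At a lattice point the translated bond pairing is the level-0 bond variable**: `k_ν(m) = A((m, ν), 0) = approxTop 0 ψ (m, ν)`.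
[cite: Federbush1986PhaseCellI, (2.1)–(2.2) p. 325] -/
theorem bpairT_latPt (ν : Fin 4) (m : Fin 4 → ℤ) : bpairT ψ ν (latPt m) = approxTop 0 ψ ⟨m, ν⟩ := by
  rw [approxTop_eq_integral_bondWeight]
  unfold bpairT
  have h := integral_add_right_eq_self (μ := (volume : Measure E4))
    (fun w => bondWeight (⟨m, ν⟩ : Edge 0) w * ψ w ν) (latPt m)
  rw [← h]
  refine integral_congr_ae (ae_of_all _ fun z => ?_)
  dsimp only
  congr 1
  rw [show (⟨m, ν⟩ : Edge 0) = ⟨0 + m, ν⟩ by simp, bondWeight_base_add 0 m ν (z + latPt m), edge_src_zero,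
    add_sub_cancel_right]

/-- A continuous compactly supported test field is bounded. [folklore] -/
private theorem exists_bound' (hcont : Continuous ψ) (hsupp : HasCompactSupport ψ) : ∃ B, 0 ≤ B ∧ ∀ y μ, |ψ y μ| ≤ B := by
  obtain ⟨B, hB⟩ := hsupp.exists_bound_of_continuous hcont
  refine ⟨max B 0, le_max_right _ _, fun y μ => ?_⟩
  have h := (norm_le_pi_norm (ψ y) μ).trans (hB y)
  rw [Real.norm_eq_abs] at h
  exact h.trans (le_max_left _ _)

/-- The translated bond pairing is continuous. [cite: Federbush1986PhaseCellI, (2.1) p. 325] -/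
theorem continuous_bpairT (hcont : Continuous ψ) (hsupp : HasCompactSupport ψ) (ν : Fin 4) : Continuous (bpairT ψ ν) := by
  obtain ⟨B, hB0, hB⟩ := exists_bound' hcont hsupp
  unfold bpairT
  refine continuous_of_dominated (bound := fun z => |bondWeight (⟨0, ν⟩ : Edge 0) z| * B) (fun y => ?_)
    (fun y => ae_of_all _ fun z => ?_) ?_ (ae_of_all _ fun z => ?_)
  · exact (integrable_bondWeight_mul (hcont.comp (continuous_add_const y)) _ ν).aestronglyMeasurable
  · rw [Real.norm_eq_abs, abs_mul]
    exact mul_le_mul_of_nonneg_left (hB _ _) (abs_nonneg _)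
  · exact (integrable_bondWeight _).abs.mul_const B
  · exact continuous_const.mul ((continuous_apply ν).comp (hcont.comp (continuous_const_add z)))

/-- The translated bond pairing is compactly supported. [cite: Federbush1986PhaseCellI, (2.1) p. 325] -/
theorem hasCompactSupport_bpairT (hsupp : HasCompactSupport ψ) (ν : Fin 4) : HasCompactSupport (bpairT ψ ν) := by
  obtain ⟨R, hR⟩ := (hsupp.isCompact.isBounded).subset_closedBall 0
  refine HasCompactSupport.intro (isCompact_closedBall (0 : E4) (R + 4)) fun y hy => ?_
  rw [Metric.mem_closedBall, dist_zero_right, not_le] at hy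
  unfold bpairT
  refine (integral_congr_ae (ae_of_all _ fun z => ?_)).trans (integral_zero _ _)
  by_cases hz : 4 < ‖z‖
  · rw [bondWeight_edge0_eq_zero ν hz, zero_mul]
  · have hzy : ψ (z + y) = 0 := by
      apply image_eq_zero_of_notMem_tsupport
      intro hmem
      have h := hR hmem
      rw [Metric.mem_closedBall, dist_zero_right] at h
      have : ‖y‖ ≤ ‖z + y‖ + ‖z‖ := by
        have := norm_sub_le (z + y) z; rwa [add_sub_cancel_left] at this
      linarith [not_lt.mp hz]
    rw [hzy, Pi.zero_apply, mul_zero]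

/-- Outside the ball of radius `R + 4` (`ψ` supported in the ball of radius `R`) the translated bond pairing vanishes.
[cite: Federbush1986PhaseCellI, (2.1) p. 325] -/
theorem bpairT_eq_zero_of_norm {R : ℝ} (hR : ∀ y, R < ‖y‖ → ψ y = 0) (ν : Fin 4) {y : E4} (hy : R + 4 < ‖y‖) :
    bpairT ψ ν y = 0 := by
  unfold bpairT
  refine (integral_congr_ae (ae_of_all _ fun z => ?_)).trans (integral_zero _ _)
  by_cases hz : 4 < ‖z‖
  · rw [bondWeight_edge0_eq_zero ν hz, zero_mul]
  · have : ‖y‖ ≤ ‖z + y‖ + ‖z‖ := by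
      have := norm_sub_le (z + y) z; rwa [add_sub_cancel_left] at this
    rw [hR (z + y) (by linarith [not_lt.mp hz]), Pi.zero_apply, mul_zero]

/-- `bpairTC` is continuous. [cite: Federbush1986PhaseCellI, (2.1) p. 325] -/
theorem continuous_bpairTC (hcont : Continuous ψ) (hsupp : HasCompactSupport ψ) (ν : Fin 4) : Continuous (bpairTC ψ ν) :=
  continuous_ofReal.comp (continuous_bpairT hcont hsupp ν)

/-- `bpairTC` is integrable. [cite: Federbush1986PhaseCellI, (2.1) p. 325] -/
theorem integrable_bpairTC (hcont : Continuous ψ) (hsupp : HasCompactSupport ψ) (ν : Fin 4) : Integrable (bpairTC ψ ν) :=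
  (continuous_bpairTC hcont hsupp ν).integrable_of_hasCompactSupport
    ((hasCompactSupport_bpairT hsupp ν).comp_left (g := fun t : ℝ => (t : ℂ)) Complex.ofReal_zero)

/-- **The transform of a translated one-component pairing factorises**: for an integrable real kernel `K`,
`∫ e^{ip·y} (∫ K(z) ψ_ν(z + y) dz) dy = K̂(p) Ψ_ν(p)` with `K̂(p) = ∫ e^{−ip·z} K(z)` (Fubini after the shear `(z, y) ↦ (z, z + y)`).
[cite: Federbush1986PhaseCellI, (3.6)–(3.7) p. 327, (3.10)–(3.12) p. 328] -/
theorem hatE_transPair {K : E4 → ℝ} (hK : Integrable K) (hψ : ContDiff ℝ ∞ ψ) (hsupp : HasCompactSupport ψ) (ν : Fin 4)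
    (p : Fin 4 → ℝ) :
    hatE (fun y => (((∫ z, K z * ψ (z + y) ν : ℝ) : ℂ))) p = (∫ z, cphase p z * ((K z : ℝ) : ℂ)) * tfT ψ ν p := by
  have hcont : Continuous ψ := hψ.continuous
  obtain ⟨B, hB0, hB⟩ := exists_bound' hcont hsupp
  set χ : E4 → ℂ := fun z => ((K z : ℝ) : ℂ) with hχ_def
  have hχi : Integrable χ := hK.ofReal
  have hψC : ∀ y, ‖cpt ψ ν y‖ ≤ B := fun y => by
    rw [cpt, Complex.norm_real, Real.norm_eq_abs]; exact hB y ν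
  have hcptc : Continuous (cpt ψ ν) := (contDiff_cpt hψ ν).continuous
  set G : E4 → E4 → ℂ := fun z y => phase y (toC p) * (χ z * cpt ψ ν (z + y)) with hG_def
  have hGint : Integrable (Function.uncurry G) (volume.prod volume) := by
    have h1 : Integrable (fun z : E4 => cphase p z * χ z) :=
      hχi.bdd_mul (c := 1) (continuous_cphase p).aestronglyMeasurable (ae_of_all _ fun z => (norm_cphase p z).le)
    have h2 : Integrable (fun w : E4 => phase w (toC p) * cpt ψ ν w) :=
      (integrable_cpt hψ hsupp ν).bdd_mul (c := 1)
        ((continuous_phase_toC.comp (Continuous.prodMk_left p)).aestronglyMeasurable)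
        (ae_of_all _ fun w => (norm_phase_toC w p).le)
    have hH : Integrable (fun zw : E4 × E4 => (cphase p zw.1 * χ zw.1) * (phase zw.2 (toC p) * cpt ψ ν zw.2))
        (volume.prod volume) := h1.mul_prod h2
    have hS := (measurePreserving_prod_add (volume : Measure E4) (volume : Measure E4)).integrable_comp hH.aestronglyMeasurable
    have hcomp : (fun zw : E4 × E4 => (cphase p zw.1 * χ zw.1) * (phase zw.2 (toC p) * cpt ψ ν zw.2))
        ∘ (fun zy : E4 × E4 => (zy.1, zy.1 + zy.2)) = Function.uncurry G := by
      funext zy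
      simp only [Function.comp_apply, hG_def, phase_toC_add, Function.uncurry]
      have := cphase_mul_phase p zy.1
      calc cphase p zy.1 * χ zy.1 * (phase zy.1 (toC p) * phase zy.2 (toC p) * cpt ψ ν (zy.1 + zy.2))
          = (cphase p zy.1 * phase zy.1 (toC p)) * (phase zy.2 (toC p) * (χ zy.1 * cpt ψ ν (zy.1 + zy.2))) := by ring
        _ = phase zy.2 (toC p) * (χ zy.1 * cpt ψ ν (zy.1 + zy.2)) := by rw [this, one_mul]
    rw [hcomp] at hS
    exact hS.mpr hH
  have hGz : ∀ y, Integrable (fun z => G z y) := by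
    intro y
    have h := hχi.bdd_mul (c := B) (f := fun z => phase y (toC p) * cpt ψ ν (z + y))
      ((continuous_const.mul (hcptc.comp (continuous_add_const y))).aestronglyMeasurable)
      (ae_of_all _ fun z => by rw [norm_mul, norm_phase_toC, one_mul]; exact hψC (z + y))
    refine h.congr (ae_of_all _ fun z => ?_)
    simp only [hG_def]; ring
  -- Step 1: `e^{ip·y} k(y) = ∫ dz G(z, y)` for every `y`
  have h1 : ∀ y : E4, cexp (I * ∑ k, (p k : ℂ) * ((y k : ℝ) : ℂ)) * (((∫ z, K z * ψ (z + y) ν : ℝ) : ℂ))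
      = ∫ z, G z y := by
    intro y
    rw [← integral_complex_ofReal, ← integral_const_mul]
    refine integral_congr_ae (ae_of_all _ fun z => ?_)
    simp only [hG_def, hχ_def, cpt, Complex.ofReal_mul, phase_toC_eq_cexp]
  -- Step 2: the inner `y`-integral after Fubini
  have h2 : ∀ z : E4, ∫ y, G z y = χ z * (cphase p z * tfT ψ ν p) := by
    intro z
    have hg : (fun y => G z y) = fun y => χ z * ((fun w => phase (w - z) (toC p) * cpt ψ ν w) (y + z)) := by
      funext y
      simp only [hG_def, add_sub_cancel_right, add_comm z y]
      ring
    rw [hg, integral_const_mul, integral_add_right_eq_self (fun w => phase (w - z) (toC p) * cpt ψ ν w) z]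
    congr 1
    simp_rw [phase_toC_sub _ z p, mul_assoc]
    rw [integral_const_mul]
    rfl
  unfold hatE
  simp_rw [h1]
  rw [← integral_integral_swap hGint]
  simp_rw [h2]
  rw [← integral_mul_const]
  refine integral_congr_ae (ae_of_all _ fun z => ?_)
  simp only [hχ_def]
  ring

/-- The bare transform of the origin bond weight: `b̂⁰_ν(p) = ∫ e^{−ip·z} b_{(0,ν)}(z) d⁴z` (`= b̂_ν(p)` off the coordinate
hyperplanes, `bondHat_eq_bondFactor`). [cite: Federbush1986PhaseCellI, (2.1)–(2.2) p. 325, (3.10) p. 328] -/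
def bondHat (ν : Fin 4) (p : Fin 4 → ℝ) : ℂ := ∫ z : E4, cphase p z * ((bondWeight (⟨0, ν⟩ : Edge 0) z : ℝ) : ℂ)

/-- `|b̂⁰_ν(p)| ≤ ‖b_{(0,ν)}‖_{L¹}` uniformly in `p`. [cite: Federbush1986PhaseCellI, (2.1)–(2.2) p. 325] -/
theorem norm_bondHat_le (ν : Fin 4) (p : Fin 4 → ℝ) : ‖bondHat ν p‖ ≤ ∫ z, |bondWeight (⟨0, ν⟩ : Edge 0) z| := by
  unfold bondHat
  refine (norm_integral_le_integral_norm _).trans (le_of_eq (integral_congr_ae (ae_of_all _ fun z => ?_)))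
  dsimp only
  rw [norm_mul, norm_cphase, one_mul, Complex.norm_real, Real.norm_eq_abs]

/-- **Off the coordinate hyperplanes `b̂⁰_ν = b̂_ν`** (the tree's `bondFactor`). [cite: Federbush1986PhaseCellI, (2.1)–(2.2) p. 325,
(3.10) p. 328; FederbushWilliamson1987PhaseCellII, (1.7) p. 1416] -/
theorem bondHat_eq_bondFactor (ν : Fin 4) {p : Fin 4 → ℝ} (hp : ∀ k, p k ≠ 0) : bondHat ν p = bondFactor ν p := by
  unfold bondHat cphase
  rw [fourier_bondWeight_level0 0 ν hp]
  simp

/-- **The transform of the translated bond pairing**: `k̂_ν(p) = b̂⁰_ν(p) Ψ_ν(p)` for every real `p`.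
[cite: Federbush1986PhaseCellI, (3.6)–(3.7) p. 327, (3.10)–(3.12) p. 328] -/
theorem hatE_bpairTC (hψ : ContDiff ℝ ∞ ψ) (hsupp : HasCompactSupport ψ) (ν : Fin 4) (p : Fin 4 → ℝ) :
    hatE (bpairTC ψ ν) p = bondHat ν p * tfT ψ ν p :=
  hatE_transPair (integrable_bondWeight _) hψ hsupp ν p

/-- The transform of the translated bond pairing has inverse-square product decay. [cite: FederbushWilliamson1987PhaseCellII, (6.8) p. 1418] -/
theorem invSqDecay_hatE_bpairTC (hψ : ContDiff ℝ ∞ ψ) (hsupp : HasCompactSupport ψ) (ν : Fin 4) :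
    ∃ C, HasInvSqDecay (hatE (bpairTC ψ ν)) C := by
  obtain ⟨C, hC⟩ := tfT_invSqDecay hψ hsupp ν
  refine ⟨(∫ z, |bondWeight (⟨0, ν⟩ : Edge 0) z|) * C, ?_⟩
  have h := hC.mul_bounded (F := bondHat ν) (norm_bondHat_le ν)
  intro p
  rw [hatE_bpairTC hψ hsupp ν p]
  exact h p

/-! ## §3 Poisson summation in EQUALITY form: a periodisation with finitely many non-zero lattice values is a trigonometric polynomial -/

/-- The momentum cell has finite volume. [cite: FederbushWilliamson1987PhaseCellII, (3.1) p. 1417] -/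
theorem volume_cell_lt_top : volume (cell : Set (Fin 4 → ℝ)) < ⊤ := by
  refine lt_of_le_of_lt (measure_mono ?_) (isCompact_Icc (a := fun _ : Fin 4 => (0 : ℝ)) (b := fun _ => 2 * Real.pi)).measure_lt_top
  intro p hp
  exact ⟨fun k => (hp k (Set.mem_univ k)).1, fun k => (hp k (Set.mem_univ k)).2.le⟩

/-- `cell` is measurable. [cite: FederbushWilliamson1987PhaseCellII, (3.1) p. 1417] -/
theorem measurableSet_cell' : MeasurableSet (cell : Set (Fin 4 → ℝ)) := MeasurableSet.univ_pi fun _ => measurableSet_Ico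

/-- The cell lies in the closed box `[0, 2π]⁴`. [cite: FederbushWilliamson1987PhaseCellII, (3.1) p. 1417] -/
theorem cell_subset_Icc : (cell : Set (Fin 4 → ℝ)) ⊆ Icc (fun _ => (0 : ℝ)) (fun _ => 2 * Real.pi) :=
  fun _ hp => ⟨fun k => (hp k (Set.mem_univ k)).1, fun k => (hp k (Set.mem_univ k)).2.le⟩

/-- A continuous function is integrable on the cell. [cite: FederbushWilliamson1987PhaseCellII, (3.1) p. 1417] -/
theorem integrableOn_cell_of_continuous {F : (Fin 4 → ℝ) → ℂ} (hF : Continuous F) : IntegrableOn F cell :=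
  (hF.continuousOn.integrableOn_compact isCompact_Icc).mono_set cell_subset_Icc

/-- The one-variable character integral over a period: `∫_0^{2π} e^{idt} dt = 2π δ_{d,0}` (`d ∈ ℤ`).
[cite: SteinWeiss1971, Ch. VII §1 (1.1) p. 245] -/
theorem integral_Ico_cexp_int (d : ℤ) :
    ∫ t in Ico (0 : ℝ) (2 * Real.pi), cexp (I * (d : ℂ) * (t : ℂ)) = if d = 0 then ((2 * Real.pi : ℝ) : ℂ) else 0 := by
  have h2π : (0 : ℝ) ≤ 2 * Real.pi := Real.two_pi_pos.le
  rw [integral_Ico_eq_integral_Ioo, ← integral_Ioc_eq_integral_Ioo, ← intervalIntegral.integral_of_le h2π]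
  split_ifs with hd
  · subst hd
    simp
  · have hc : (I * (d : ℂ)) ≠ 0 := mul_ne_zero I_ne_zero (by exact_mod_cast hd)
    rw [integral_exp_mul_complex (a := 0) (b := 2 * Real.pi) hc]
    have h1 : cexp (I * (d : ℂ) * ((2 * Real.pi : ℝ) : ℂ)) = 1 := by
      rw [show I * (d : ℂ) * ((2 * Real.pi : ℝ) : ℂ) = (d : ℂ) * (2 * Real.pi * I) by push_cast; ring]
      exact Complex.exp_int_mul_two_pi_mul_I d
    rw [h1]
    simp

/-- **Orthogonality of the characters on the momentum cell**: `∫_cell e^{−ip·m′} e^{ip·m} d⁴p = (2π)⁴ δ_{m,m′}`.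
[cite: SteinWeiss1971, Ch. VII §1 (1.1) p. 245; FederbushWilliamson1987PhaseCellII, (3.1) p. 1417] -/
theorem integral_cell_cexp_neg_mul_cexp (m m' : Fin 4 → ℤ) :
    ∫ p in cell, cexp (-I * ∑ k, (p k : ℂ) * (m' k : ℂ)) * cexp (I * ∑ k, (p k : ℂ) * (m k : ℂ))
      = if m = m' then (((2 * Real.pi) ^ 4 : ℝ) : ℂ) else 0 := by
  -- the integrand as a product of one-variable characters
  set g : Fin 4 → ℝ → ℂ := fun k t => cexp (I * ((m k - m' k : ℤ) : ℂ) * (t : ℂ)) with hg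
  have hprod : ∀ p : Fin 4 → ℝ, cexp (-I * ∑ k, (p k : ℂ) * (m' k : ℂ)) * cexp (I * ∑ k, (p k : ℂ) * (m k : ℂ))
      = ∏ k, g k (p k) := by
    intro p
    rw [← Complex.exp_add, hg]
    simp only
    rw [← Complex.exp_sum]
    congr 1
    rw [Finset.mul_sum, Finset.mul_sum, ← Finset.sum_add_distrib]
    refine Finset.sum_congr rfl fun k _ => ?_
    push_cast; ring
  simp_rw [hprod]
  rw [← integral_indicator measurableSet_cell']
  have hind : ∀ p : Fin 4 → ℝ, (cell : Set (Fin 4 → ℝ)).indicator (fun p => ∏ k, g k (p k)) p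
      = ∏ k, (Ico (0 : ℝ) (2 * Real.pi)).indicator (g k) (p k) := by
    intro p
    by_cases hp : p ∈ cell
    · rw [indicator_of_mem hp]
      exact Finset.prod_congr rfl fun k _ => by rw [indicator_of_mem (hp k (Set.mem_univ k))]
    · rw [indicator_of_notMem hp]
      have : ∃ k, p k ∉ Ico (0 : ℝ) (2 * Real.pi) := by
        by_contra hc
        push Not at hc
        exact hp fun k _ => hc k
      obtain ⟨k, hk⟩ := this
      exact (Finset.prod_eq_zero (Finset.mem_univ k) (by rw [indicator_of_notMem hk])).symm
  simp_rw [hind]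
  rw [integral_fintype_prod_volume_eq_prod (ι := Fin 4) (fun k (t : ℝ) => (Ico (0 : ℝ) (2 * Real.pi)).indicator (g k) t)]
  simp_rw [integral_indicator measurableSet_Ico, hg, integral_Ico_cexp_int]
  by_cases hmm : m = m'
  · subst hmm
    simp only [sub_self, if_true]
    rw [Finset.prod_const, Finset.card_univ, Fintype.card_fin]
    push_cast; ring
  · rw [if_neg hmm]
    have : ∃ k, m k - m' k ≠ 0 := by
      by_contra hc
      push Not at hc
      exact hmm (funext fun k => sub_eq_zero.mp (hc k))
    obtain ⟨k, hk⟩ := this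
    exact Finset.prod_eq_zero (Finset.mem_univ k) (by rw [if_neg hk])

/-- **Poisson summation in equality form.**  Let `h` be continuous and integrable on `ℝ⁴` with transform `ȟ` of inverse-square
product decay, and let `h(m) = 0` at every lattice point `m ∉ S` (`S ⊂ ℤ⁴` finite).  Then for EVERY real `p`,
`Σ_{n∈ℤ⁴} ȟ(p + 2πn) = Σ_{m∈S} h(m) e^{ip·m}`: both sides are continuous and `2π`-periodic with the same cell Fourier coefficients
`(2π)⁴ h(m)` (uniqueness `eq_zero_of_periodic_of_coeff_zero`). [cite: SteinWeiss1971, Ch. VII §2 Thm 2.4, Cor. 2.6 p. 252;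
Federbush1986PhaseCellI, (3.6)–(3.7) p. 327] -/
theorem perSum_hatE_eq_sum {h : E4 → ℂ} {C : ℝ} (hcont : Continuous h) (hint : Integrable h)
    (hdec : HasInvSqDecay (hatE h) C) (S : Finset (Fin 4 → ℤ)) (hzero : ∀ m ∉ S, h (toE4 fun k => (m k : ℝ)) = 0)
    (p : Fin 4 → ℝ) :
    perSum (hatE h) p = ∑ m ∈ S, h (toE4 fun k => (m k : ℝ)) * cexp (I * ∑ k, (p k : ℂ) * (m k : ℂ)) := by
  have hGc : Continuous (hatE h) := continuous_hatE hint
  have hGi : Integrable (hatE h) := hdec.integrable hGc.aestronglyMeasurable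
  have hF : Integrable (𝓕 h) := integrable_fourier_of_integrable_hatE hGi
  set T : (Fin 4 → ℝ) → ℂ := fun p => ∑ m ∈ S, h (toE4 fun k => (m k : ℝ)) * cexp (I * ∑ k, (p k : ℂ) * (m k : ℂ)) with hT
  have hTc : Continuous T := by
    refine continuous_finsetSum _ fun m _ => continuous_const.mul (Complex.continuous_exp.comp (continuous_const.mul ?_))
    exact continuous_finsetSum _ fun k _ => (continuous_ofReal.comp (continuous_apply k)).mul continuous_const
  have hPc : Continuous (perSum (hatE h)) := hdec.continuous_perSum hGc
  -- the difference `K = perSum − T` has vanishing coefficients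
  have hK := eq_zero_of_periodic_of_coeff_zero (K := fun p => perSum (hatE h) p - T p) (hPc.sub hTc)
    (fun p n => by
      simp only [hT, perSum_shiftR, cexp_phase_shiftR])
    (fun m' => by
      have hchar : Continuous fun p : Fin 4 → ℝ => cexp (-I * ∑ k, (p k : ℂ) * (m' k : ℂ)) := by fun_prop
      have hIp : IntegrableOn (fun p => cexp (-I * ∑ k, (p k : ℂ) * (m' k : ℂ)) * perSum (hatE h) p) cell := by
        refine Measure.integrableOn_of_bounded (M := 1 * (C * 7 ^ 4 * ∑' n, ModeAnalyticityLatticeSums.u n)) volume_cell_lt_top.ne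
          (hchar.mul hPc).aestronglyMeasurable (ae_of_all _ fun p => ?_)
        rw [norm_mul, show -I * ∑ k, (p k : ℂ) * (m' k : ℂ) = ((-(∑ k, p k * (m' k : ℝ)) : ℝ) : ℂ) * I by push_cast; ring,
          Complex.norm_exp_ofReal_mul_I]
        exact mul_le_mul_of_nonneg_left (hdec.norm_perSum_le p) zero_le_one
      have hIT : IntegrableOn (fun p => cexp (-I * ∑ k, (p k : ℂ) * (m' k : ℂ)) * T p) cell :=
        integrableOn_cell_of_continuous (hchar.mul hTc)
      have hTcoef : ∫ p in cell, cexp (-I * ∑ k, (p k : ℂ) * (m' k : ℂ)) * T p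
          = ∑ m ∈ S, h (toE4 fun k => (m k : ℝ)) * (if m = m' then (((2 * Real.pi) ^ 4 : ℝ) : ℂ) else 0) := by
        have hexp : ∀ p : Fin 4 → ℝ, cexp (-I * ∑ k, (p k : ℂ) * (m' k : ℂ)) * T p
            = ∑ m ∈ S, h (toE4 fun k => (m k : ℝ)) *
                (cexp (-I * ∑ k, (p k : ℂ) * (m' k : ℂ)) * cexp (I * ∑ k, (p k : ℂ) * (m k : ℂ))) := by
          intro p
          rw [hT]
          dsimp only
          rw [Finset.mul_sum S]
          exact Finset.sum_congr rfl fun m _ => by ring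
        simp_rw [hexp]
        rw [integral_finsetSum _ fun m _ => (integrableOn_cell_of_continuous (by fun_prop)).const_mul _]
        refine Finset.sum_congr rfl fun m _ => ?_
        rw [integral_const_mul, integral_cell_cexp_neg_mul_cexp m m']
      simp only [mul_sub]
      rw [integral_sub hIp hIT, integral_cell_cexp_mul_perSum hGi, integral_cexp_neg_mul_hatE hcont hint hF, hTcoef]
      by_cases hm' : m' ∈ S
      · rw [Finset.sum_eq_single_of_mem m' hm' fun m _ hne => by rw [if_neg hne, mul_zero], if_pos rfl]
        push_cast; ring
      · rw [Finset.sum_eq_zero fun m hm => by rw [if_neg (by rintro rfl; exact hm' hm), mul_zero], hzero m' hm']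
        simp)
  have := hK p
  exact sub_eq_zero.mp this

/-- **The periodised bond pairing transform is a trigonometric polynomial in the level-0 bond variables**:
`Σ_n k̂_ν(p + 2πn) = Σ_{m∈S} A((m,ν), 0) e^{ip·m}` whenever the bond variables of `ψ` vanish off `S`.
[cite: Federbush1986PhaseCellI, (2.1) p. 325, (3.6)–(3.7) p. 327; SteinWeiss1971, Ch. VII §2 Thm 2.4] -/
theorem perSum_hatE_bpairTC_eq_sum (hψ : ContDiff ℝ ∞ ψ) (hsupp : HasCompactSupport ψ) (ν : Fin 4)
    (S : Finset (Fin 4 → ℤ)) (hS : ∀ m ∉ S, approxTop 0 ψ ⟨m, ν⟩ = 0) (p : Fin 4 → ℝ) :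
    perSum (hatE (bpairTC ψ ν)) p = ∑ m ∈ S, ((approxTop 0 ψ ⟨m, ν⟩ : ℝ) : ℂ) * cexp (I * ∑ k, (p k : ℂ) * (m k : ℂ)) := by
  obtain ⟨C, hC⟩ := invSqDecay_hatE_bpairTC hψ hsupp ν
  have hval : ∀ m : Fin 4 → ℤ, bpairTC ψ ν (toE4 fun k => (m k : ℝ)) = ((approxTop 0 ψ ⟨m, ν⟩ : ℝ) : ℂ) := fun m => by
    show ((bpairT ψ ν (latPt m) : ℝ) : ℂ) = _
    rw [bpairT_latPt]
  rw [perSum_hatE_eq_sum (continuous_bpairTC hψ.continuous hsupp ν) (integrable_bpairTC hψ.continuous hsupp ν) hC S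
    (fun m hm => by rw [hval, hS m hm, Complex.ofReal_zero]) p]
  exact Finset.sum_congr rfl fun m _ => by rw [hval]

/-! ## §4 The multipliers on the real momenta: `Λ_ν = Ĵ_ν/((1/2π)² b̂_ν)` off the lattice hyperplanes; measurability, integrability on the cell -/

/-- The set of real momenta with no component in `2πℤ` (complement of the lattice hyperplanes; co-null, `ae_off_lattice`).
[cite: FederbushWilliamson1987PhaseCellII, (3.1) p. 1417] -/
def offLattice : Set (Fin 4 → ℝ) := {p | ∀ k (m : ℤ), p k ≠ 2 * Real.pi * m}

/-- `offLattice` is measurable. [cite: FederbushWilliamson1987PhaseCellII, (3.1) p. 1417] -/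
theorem measurableSet_offLattice : MeasurableSet offLattice := by
  have : offLattice = ⋂ k : Fin 4, ⋂ m : ℤ, {p : Fin 4 → ℝ | p k ≠ 2 * Real.pi * m} := by
    ext p; simp [offLattice]
  rw [this]
  refine MeasurableSet.iInter fun k => MeasurableSet.iInter fun m => ?_
  exact (measurableSet_singleton (2 * Real.pi * (m : ℝ))).compl.preimage (measurable_pi_apply k)

/-- Almost every momentum is off the lattice hyperplanes. [cite: FederbushWilliamson1987PhaseCellII, (3.1) p. 1417] -/
theorem ae_mem_offLattice : ∀ᵐ p : Fin 4 → ℝ, p ∈ offLattice := ae_off_lattice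

/-- Restricting Lebesgue measure to `offLattice` changes nothing. [cite: FederbushWilliamson1987PhaseCellII, (3.1) p. 1417] -/
theorem restrict_offLattice : (volume : Measure (Fin 4 → ℝ)).restrict offLattice = volume :=
  Measure.restrict_eq_self_of_ae_mem ae_mem_offLattice

end PlaquetteGram

namespace CorrectedMode

open PlaquetteGram ModeLinearity
open ModeDecay (toC phase modeFT modeField)
open ModeAnalyticityCorrectedGauge (Xc)

variable {ψ : E4 → Fin 4 → ℝ}

/-- **The gauge-invariant momentum current of the mode**: `Ĵ_ν(p) = p² ĝ_ν(p) − p_ν (p·ĝ(p))` (the transform side of `d*dA^N`,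
insensitive to the gauge part `pX` of `ĝ`). [cite: Federbush1986PhaseCellI, (3.4) p. 327, (3.11)–(3.12) p. 328] -/
def Jhat (s : ℕ) (ν : Fin 4) (p : Fin 4 → ℝ) : ℂ :=
  csq (toC p) * ghat s ν (toC p) - (p ν : ℂ) * ∑ k, (p k : ℂ) * ghat s k (toC p)

/-- `Ĵ_ν` is continuous on the real momenta. [cite: FederbushWilliamson1987PhaseCellII, Theorem 3.2 p. 1417] -/
theorem continuous_Jhat (s : ℕ) (ν : Fin 4) : Continuous (Jhat s ν) := by
  unfold Jhat
  have hcsq : Continuous fun p : Fin 4 → ℝ => csq (toC p) := by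
    unfold csq; simp only [toC_apply]; fun_prop
  exact (hcsq.mul (continuous_ghat_toC s ν)).sub ((continuous_ofReal.comp (continuous_apply ν)).mul
    (continuous_finsetSum _ fun k _ => (continuous_ofReal.comp (continuous_apply k)).mul (continuous_ghat_toC s k)))

/-- **`Ĵ_ν = (1/2π)² Λ_ν b̂_ν` off the lattice hyperplanes**: `p²ĝ_ν − p_ν(p·ĝ) = (1/2π)²[p²A′_ν − p_ν(p·A′)] = (1/2π)² p²A′_ν`
(Landau gauge) `= (1/2π)² Λ_ν b̂_ν`. [cite: Federbush1986PhaseCellI, (3.4) p. 327, (3.11)–(3.12) p. 328; FederbushWilliamson1987PhaseCellII, (2.1), (2.4) p. 1417] -/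
theorem Jhat_eq (s : ℕ) (ν : Fin 4) {p : Fin 4 → ℝ} (hp : ∀ k (m : ℤ), p k ≠ 2 * Real.pi * m) :
    Jhat s ν p = ((kR : ℝ) : ℂ) * (Lam ν (toC p) * bondFactor ν p) := by
  have hp0 : ∀ k, p k ≠ 0 := fun k h => hp k 0 (by simpa using h)
  have hpC : ∀ i, toC p i ≠ 0 := fun i => by rw [toC_apply]; exact_mod_cast hp0 i
  have hL : ∑ k, toC p k * Aprime k (toC p) = 0 := sum_coord_mul_Aprime hpC
  have hΛ : Lam ν (toC p) * bondFactor ν p = csq (toC p) * Aprime ν (toC p) := (csq_mul_Aprime_eq hp ν).symm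
  have hcsq : csq (toC p) = ∑ k, (p k : ℂ) ^ 2 := by simp [csq, toC_apply]
  unfold Jhat
  simp_rw [ghat_toC_eq s _ hp]
  rw [hΛ]
  simp only [toC_apply, Fin.sum_univ_four] at hL hcsq ⊢
  rw [hcsq]
  linear_combination (-((kR : ℝ) : ℂ) * (p ν : ℂ)) * hL

/-- `b̂_ν(p) ≠ 0` off the lattice hyperplanes. [cite: FederbushWilliamson1987PhaseCellII, (1.7) p. 1416] -/
theorem bondFactor_ne_zero (ν : Fin 4) {p : Fin 4 → ℝ} (hp : ∀ k (m : ℤ), p k ≠ 2 * Real.pi * m) : bondFactor ν p ≠ 0 := by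
  have hp0 : ∀ k, p k ≠ 0 := fun k h => hp k 0 (by simpa using h)
  have hf : ∀ k, f (toC p) k ≠ 0 := fun k => f_toC_ne_zero (hp k)
  rw [bondFactor_eq, rL0]
  simp only [toC_apply, neg_mul, ne_eq, neg_eq_zero, div_eq_zero_iff, mul_eq_zero, I_ne_zero, false_or, hf ν,
    or_false, Complex.ofReal_eq_zero, hp0 ν]
  rw [Finset.prod_eq_zero_iff]
  push Not
  intro k _
  exact div_ne_zero (hf k) (by exact_mod_cast hp0 k)

/-- `b̂_ν` is continuous off the coordinate hyperplanes. [cite: FederbushWilliamson1987PhaseCellII, (1.7) p. 1416] -/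
theorem continuousOn_bondFactor (ν : Fin 4) : ContinuousOn (bondFactor ν) offLattice := by
  have hp0 : ∀ p ∈ offLattice, ∀ k, (p k : ℂ) ≠ 0 := fun p hp k => by
    have : p k ≠ 0 := fun h => hp k 0 (by simpa using h)
    exact_mod_cast this
  unfold bondFactor
  refine ContinuousOn.mul (continuousOn_finsetProd _ fun k _ => ?_) ?_
  · exact ContinuousOn.div (by fun_prop) (continuous_ofReal.comp (continuous_apply k)).continuousOn fun p hp => hp0 p hp k
  · exact ContinuousOn.div (by fun_prop) (by fun_prop) fun p hp => pow_ne_zero _ (hp0 p hp ν)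

/-- **`Λ_ν = Ĵ_ν / ((1/2π)² b̂_ν)` off the lattice hyperplanes.** [cite: Federbush1986PhaseCellI, (3.4) p. 327, (3.11)–(3.12) p. 328] -/
theorem Lam_toC_eq_Jhat_div (s : ℕ) (ν : Fin 4) {p : Fin 4 → ℝ} (hp : ∀ k (m : ℤ), p k ≠ 2 * Real.pi * m) :
    Lam ν (toC p) = Jhat s ν p / (((kR : ℝ) : ℂ) * bondFactor ν p) := by
  have hk : ((kR : ℝ) : ℂ) ≠ 0 := by
    rw [Ne, Complex.ofReal_eq_zero]; unfold kR; positivity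
  rw [Jhat_eq s ν hp, eq_div_iff (mul_ne_zero hk (bondFactor_ne_zero ν hp))]
  ring

/-- `p ↦ Λ_ν(p)` is continuous off the lattice hyperplanes. [cite: FederbushWilliamson1987PhaseCellII, (2.1) p. 1417, §III p. 1417] -/
theorem continuousOn_Lam_toC (ν : Fin 4) : ContinuousOn (fun p : Fin 4 → ℝ => Lam ν (toC p)) offLattice := by
  have h : ContinuousOn (fun p => Jhat 0 ν p / (((kR : ℝ) : ℂ) * bondFactor ν p)) offLattice :=
    (continuous_Jhat 0 ν).continuousOn.div (continuousOn_const.mul (continuousOn_bondFactor ν)) fun p hp =>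
      mul_ne_zero (by rw [Ne, Complex.ofReal_eq_zero]; unfold kR; positivity) (bondFactor_ne_zero ν hp)
  exact h.congr fun p hp => Lam_toC_eq_Jhat_div 0 ν hp

/-- `p ↦ Λ_ν(p)` is a.e.-strongly measurable on `ℝ⁴`. [cite: FederbushWilliamson1987PhaseCellII, (2.1) p. 1417] -/
theorem aestronglyMeasurable_Lam_toC (ν : Fin 4) : AEStronglyMeasurable (fun p : Fin 4 → ℝ => Lam ν (toC p)) volume := by
  rw [← restrict_offLattice]
  exact (continuousOn_Lam_toC ν).aestronglyMeasurable measurableSet_offLattice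

/-- The uniform bound on `Λ_ν` holds almost everywhere. [cite: FederbushWilliamson1987PhaseCellII, (2.1) p. 1417, §V p. 1418] -/
theorem ae_norm_Lam_toC_le (ν : Fin 4) :
    ∀ᵐ p : Fin 4 → ℝ, ‖Lam ν (toC p)‖ ≤ 1 / (2 * Real.pi) ^ 2 / c0 := by
  filter_upwards [ae_off_lattice] with p hp
  exact norm_Lam_toC_le hp ν

/-- **`Λ_ν · g` is integrable on the momentum cell** for every bounded continuous `g` (bounded measurable on a set of finite
measure). [cite: FederbushWilliamson1987PhaseCellII, (2.1) p. 1417, (3.1) p. 1417] -/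
theorem integrableOn_Lam_toC_mul (ν : Fin 4) {g : (Fin 4 → ℝ) → ℂ} (hg : Continuous g) {B : ℝ} (hB : ∀ p, ‖g p‖ ≤ B) :
    IntegrableOn (fun p : Fin 4 → ℝ => Lam ν (toC p) * g p) cell := by
  refine Measure.integrableOn_of_bounded (M := 1 / (2 * Real.pi) ^ 2 / c0 * B) volume_cell_lt_top.ne
    ((aestronglyMeasurable_Lam_toC ν).mul hg.aestronglyMeasurable) (ae_restrict_of_ae ?_)
  filter_upwards [ae_norm_Lam_toC_le ν] with p hp
  rw [norm_mul]
  exact mul_le_mul hp (hB p) (norm_nonneg _) ((norm_nonneg _).trans hp)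

/-- The character `e^{ip·m}` is continuous and unimodular. [cite: FederbushWilliamson1987PhaseCellII, (3.1) p. 1417] -/
theorem norm_cexp_pos_phase (p : Fin 4 → ℝ) (m : Fin 4 → ℤ) : ‖cexp (I * ∑ k, (p k : ℂ) * (m k : ℂ))‖ = 1 := by
  rw [show I * ∑ k, (p k : ℂ) * (m k : ℂ) = ((∑ k, p k * (m k : ℝ) : ℝ) : ℂ) * I by push_cast; ring,
    Complex.norm_exp_ofReal_mul_I]

/-- **`Λ_ν e^{ip·m}` is integrable on the momentum cell.** [cite: FederbushWilliamson1987PhaseCellII, (2.1) p. 1417, (3.1) p. 1417] -/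
theorem integrableOn_Lam_toC_mul_cexp (ν : Fin 4) (m : Fin 4 → ℤ) :
    IntegrableOn (fun p : Fin 4 → ℝ => Lam ν (toC p) * cexp (I * ∑ k, (p k : ℂ) * (m k : ℂ))) cell :=
  integrableOn_Lam_toC_mul ν (by fun_prop) fun p => (norm_cexp_pos_phase p m).le

/-- **THE BOND MULTIPLIERS** `μ_{(m,ν)} := Re (1/2π)² ∫_cell Λ_ν(p) e^{ip·m} d⁴p` — the Fourier coefficients on `ℤ⁴` of the
periodic multiplier `Λ_ν` of `p²A′_ν = Λ_ν b̂_ν` (I (3.11): `A′ = α²C Σ_γ β_γ χ_γ`, «alternatively … Lagrange multipliers»).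
[cite: Federbush1986PhaseCellI, (3.4) p. 327, (3.11) p. 328; FederbushWilliamson1987PhaseCellII, (2.1) p. 1417] -/
def bondMult (ν : Fin 4) (m : Fin 4 → ℤ) : ℝ :=
  ((((kR : ℝ) : ℂ) * ∫ p in cell, Lam ν (toC p) * cexp (I * ∑ k, (p k : ℂ) * (m k : ℂ))).re)

/-! ## §5 The Euler–Lagrange equation WITH MULTIPLIERS: `⟨F(A^N), F(ψ)⟩ = Σ_e μ_e · A_ψ(e, 0)` for EVERY test field -/

/-- The bond form of the cross integrand: `W_b(p) = (1/2π)² Σ_ν Λ_ν(p) b̂_ν(p) Ψ_ν(p)` (`= Wfun` off the lattice hyperplanes).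
[cite: Federbush1986PhaseCellI, (3.4) p. 327, (3.11)–(3.12) p. 328] -/
def Wbond (ψ : E4 → Fin 4 → ℝ) (p : Fin 4 → ℝ) : ℂ :=
  ((kR : ℝ) : ℂ) * ∑ ν, Lam ν (toC p) * bondFactor ν p * tfT ψ ν p

/-- `Wfun = W_b` off the lattice hyperplanes (`Λ` is a co-boundary, `sum_Lam_bondFactor_eq`). [cite: Federbush1986PhaseCellI, (3.11) p. 328] -/
theorem Wfun_eq_Wbond (ψ : E4 → Fin 4 → ℝ) {p : Fin 4 → ℝ} (hp : ∀ k (m : ℤ), p k ≠ 2 * Real.pi * m) :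
    Wfun ψ p = Wbond ψ p := by
  rw [Wbond, Wfun, sum_Lam_bondFactor_eq ψ hp]; ring

/-- The cross integrand equals `W_b` almost everywhere. [cite: Federbush1986PhaseCellI, (3.4) p. 327, (3.11)–(3.12) p. 328] -/
theorem crossIntegrand_ae_eq_Wbond (s : ℕ) (hψ : ContDiff ℝ ∞ ψ) (hsupp : HasCompactSupport ψ) :
    crossIntegrand s ψ =ᵐ[volume] Wbond ψ := by
  filter_upwards [ae_off_lattice] with p hp
  rw [crossIntegrand_eq_Wfun s hψ hsupp hp, Wfun_eq_Wbond ψ hp]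

/-- **The lattice sum of the bond form**: off the lattice hyperplanes,
`Σ_n W_b(p + 2πn) = (1/2π)² Σ_ν Λ_ν(p) Σ_{m∈S} A_ψ((m,ν), 0) e^{ip·m}` (`Λ_ν` periodic; Poisson in equality form for `k̂_ν = b̂_νΨ_ν`).
[cite: Federbush1986PhaseCellI, (3.4) p. 327, (3.6)–(3.7) p. 327, (3.11) p. 328] -/
theorem tsum_Wbond_shiftR_eq (hψ : ContDiff ℝ ∞ ψ) (hsupp : HasCompactSupport ψ) (S : Finset (Fin 4 → ℤ))
    (hS : ∀ ν, ∀ m ∉ S, approxTop 0 ψ ⟨m, ν⟩ = 0) {p : Fin 4 → ℝ} (hp : ∀ k (m : ℤ), p k ≠ 2 * Real.pi * m) :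
    ∑' n : Fin 4 → ℤ, Wbond ψ (shiftR p n)
      = ((kR : ℝ) : ℂ) * ∑ ν, Lam ν (toC p) *
          ∑ m ∈ S, ((approxTop 0 ψ ⟨m, ν⟩ : ℝ) : ℂ) * cexp (I * ∑ k, (p k : ℂ) * (m k : ℂ)) := by
  -- termwise: `b̂_ν Ψ_ν = k̂_ν` at the shifted momenta (all their components are non-zero)
  have hbk : ∀ ν (n : Fin 4 → ℤ), bondFactor ν (shiftR p n) * tfT ψ ν (shiftR p n) = hatE (bpairTC ψ ν) (shiftR p n) := by
    intro ν n
    rw [hatE_bpairTC hψ hsupp ν, bondHat_eq_bondFactor ν fun k => shiftR_ne_zero (hp k) n]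
  have h1 : ∀ n : Fin 4 → ℤ, Wbond ψ (shiftR p n)
      = ∑ ν, (((kR : ℝ) : ℂ) * Lam ν (toC p)) * hatE (bpairTC ψ ν) (shiftR p n) := by
    intro n
    rw [Wbond, Finset.mul_sum]
    refine Finset.sum_congr rfl fun ν _ => ?_
    rw [toC_shiftR, Lam_shift, mul_assoc, hbk ν n, ← mul_assoc]
  have hsum : ∀ ν, Summable fun n : Fin 4 → ℤ => hatE (bpairTC ψ ν) (shiftR p n) := fun ν => by
    obtain ⟨C, hC⟩ := invSqDecay_hatE_bpairTC hψ hsupp ν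
    exact hC.summable_shiftR p
  simp_rw [h1]
  rw [Summable.tsum_finsetSum (fun ν _ => (hsum ν).mul_left _), Finset.mul_sum]
  refine Finset.sum_congr rfl fun ν _ => ?_
  rw [tsum_mul_left, show ∑' n : Fin 4 → ℤ, hatE (bpairTC ψ ν) (shiftR p n) = perSum (hatE (bpairTC ψ ν)) p from rfl,
    perSum_hatE_bpairTC_eq_sum hψ hsupp ν S (hS ν) p, mul_assoc]

/-- **THE EULER–LAGRANGE EQUATION OF (3.4) WITH LAGRANGE MULTIPLIERS.**  For EVERY smooth compactly supported test field `ψ`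
(no constraint on it) and every finite `S ⊂ ℤ⁴` off which the level-0 bond variables of `ψ` vanish,
`∫ d⁴x Σ_{μ<ν} F_{μν}(A^N)(x) F_{μν}(ψ)(x) = Σ_ν Σ_{m∈S} μ_{(m,ν)} · A_ψ((m,ν), 0)`:
the first variation of the continuum action at the explicit field is a fixed linear combination of the level-0 bond variables
(2.1) of the variation, with coefficients the bond multipliers `μ` — print's «(Alternatively one could use Lagrange multipliers.)».
[cite: Federbush1986PhaseCellI, §3 (3.4) p. 327, (3.11)–(3.12) p. 328; FederbushWilliamson1987PhaseCellII, (2.1) p. 1417] -/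
theorem integral_crossDensity_field_eq_sum_bondMult (s : ℕ) (hψ : ContDiff ℝ ∞ ψ) (hsupp : HasCompactSupport ψ)
    (S : Finset (Fin 4 → ℤ)) (hS : ∀ ν, ∀ m ∉ S, approxTop 0 ψ ⟨m, ν⟩ = 0) :
    ∫ x, crossDensity (field s) ψ x = ∑ ν, ∑ m ∈ S, bondMult ν m * approxTop 0 ψ ⟨m, ν⟩ := by
  rw [integral_crossDensity_eq s hψ hsupp]
  have hae := crossIntegrand_ae_eq_Wbond s hψ hsupp
  have hWint : Integrable (Wbond ψ) := (integrable_crossIntegrand s hψ hsupp).congr hae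
  rw [integral_congr_ae hae, integral_eq_integral_cell_tsum hWint]
  have hae2 : ∀ᵐ p : Fin 4 → ℝ, p ∈ cell → ∑' n : Fin 4 → ℤ, Wbond ψ (shiftR p n)
      = ∑ ν, ∑ m ∈ S, ((approxTop 0 ψ ⟨m, ν⟩ : ℝ) : ℂ) *
          (((kR : ℝ) : ℂ) * (Lam ν (toC p) * cexp (I * ∑ k, (p k : ℂ) * (m k : ℂ)))) := by
    filter_upwards [ae_off_lattice] with p hp _
    rw [tsum_Wbond_shiftR_eq hψ hsupp S hS hp, Finset.mul_sum]
    refine Finset.sum_congr rfl fun ν _ => ?_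
    rw [Finset.mul_sum, Finset.mul_sum]
    exact Finset.sum_congr rfl fun m _ => by ring
  rw [setIntegral_congr_ae measurableSet_cell' hae2,
    integral_finsetSum _ fun ν _ => integrable_finsetSum _ fun m _ =>
      ((integrableOn_Lam_toC_mul_cexp ν m).const_mul _).const_mul _,
    Complex.re_sum]
  refine Finset.sum_congr rfl fun ν _ => ?_
  rw [integral_finsetSum _ fun m _ => ((integrableOn_Lam_toC_mul_cexp ν m).const_mul _).const_mul _, Complex.re_sum]
  refine Finset.sum_congr rfl fun m _ => ?_
  rw [integral_const_mul, integral_const_mul, Complex.re_ofReal_mul, bondMult, mul_comm]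

/-- A smooth compactly supported field has only finitely many non-zero level-0 bond variables: they vanish off the box
`S_N = [−N, N]⁴ ∩ ℤ⁴`, `N = ⌈R + 4⌉` (`ψ` supported in the ball of radius `R`). [cite: Federbush1986PhaseCellI, (2.1) p. 325] -/
theorem exists_finset_approxTop_eq_zero (hsupp : HasCompactSupport ψ) :
    ∃ S : Finset (Fin 4 → ℤ), ∀ ν, ∀ m ∉ S, approxTop 0 ψ ⟨m, ν⟩ = 0 := by
  obtain ⟨R, hR⟩ := (hsupp.isCompact.isBounded).subset_closedBall 0
  have hR' : ∀ y : E4, R < ‖y‖ → ψ y = 0 := fun y hy => by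
    apply image_eq_zero_of_notMem_tsupport
    intro hmem
    have h := hR hmem
    rw [Metric.mem_closedBall, dist_zero_right] at h
    linarith
  set N : ℕ := ⌈R + 4⌉₊ with hN
  refine ⟨Fintype.piFinset fun _ : Fin 4 => Finset.Icc (-(N : ℤ)) N, fun ν m hm => ?_⟩
  rw [Fintype.mem_piFinset] at hm
  push Not at hm
  obtain ⟨k, hk⟩ := hm
  rw [Finset.mem_Icc, not_and_or, not_le, not_le] at hk
  have hmk : (N : ℝ) + 1 ≤ |(m k : ℝ)| := by
    rcases hk with h | h
    · have : m k ≤ -(N : ℤ) - 1 := by omega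
      have : (m k : ℝ) ≤ -(N : ℝ) - 1 := by exact_mod_cast this
      rw [abs_of_neg (by linarith)]; linarith
    · have : (N : ℤ) + 1 ≤ m k := by omega
      have : (N : ℝ) + 1 ≤ (m k : ℝ) := by exact_mod_cast this
      rw [abs_of_pos (by linarith)]; linarith
  have hnorm : |(m k : ℝ)| ≤ ‖latPt m‖ := by
    have h1 : |(m k : ℝ)| ^ 2 ≤ ‖latPt m‖ ^ 2 := by
      rw [EuclideanSpace.norm_sq_eq]
      have : ‖latPt m k‖ ^ 2 = |(m k : ℝ)| ^ 2 := by simp [latPt, toE4, Real.norm_eq_abs]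
      rw [← this]
      exact Finset.single_le_sum (f := fun j => ‖latPt m j‖ ^ 2) (fun j _ => sq_nonneg _) (Finset.mem_univ k)
    exact (sq_le_sq₀ (abs_nonneg _) (norm_nonneg _)).mp h1
  have hRN : R + 4 < ‖latPt m‖ := by
    have := Nat.le_ceil (R + 4); rw [← hN] at this; linarith
  rw [← bpairT_latPt]
  exact bpairT_eq_zero_of_norm hR' ν hRN

/-- **The Euler–Lagrange equation with multipliers, quantifier-free form**: for every smooth compactly supported `ψ` there is a
finite set of lattice sites carrying all its level-0 bond variables, and the first variation of the action at `A^N` along `ψ` is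
`Σ μ_e A_ψ(e, 0)` over those bonds. [cite: Federbush1986PhaseCellI, §3 (3.4) p. 327, (3.11) p. 328] -/
theorem integral_crossDensity_field_eq_sum_bondMult' (s : ℕ) (hψ : ContDiff ℝ ∞ ψ) (hsupp : HasCompactSupport ψ) :
    ∃ S : Finset (Fin 4 → ℤ), (∀ ν, ∀ m ∉ S, approxTop 0 ψ ⟨m, ν⟩ = 0) ∧
      ∫ x, crossDensity (field s) ψ x = ∑ ν, ∑ m ∈ S, bondMult ν m * approxTop 0 ψ ⟨m, ν⟩ := by
  obtain ⟨S, hS⟩ := exists_finset_approxTop_eq_zero hsupp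
  exact ⟨S, hS, integral_crossDensity_field_eq_sum_bondMult s hψ hsupp S hS⟩

/-! ## §6 The bond multipliers form a divergence-free lattice current: they see only plaquette variables -/

/-- **`Σ_ν (μ_{(m,ν)} − μ_{(m − e_ν, ν)}) = 0` at every lattice site `m`** — the lattice divergence of `μ` vanishes, i.e. `μ`
annihilates the bond variables of every lattice gradient (pure gauge): in momentum space this is `Σ_ν Λ_ν f_ν = 0` (`Σ_i l_i = 0`,
the Landau gauge of (2.1)–(2.3)). [cite: Federbush1986PhaseCellI, (3.4) p. 327 (constraint on PLAQUETTE variables), (3.11) p. 328;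
FederbushWilliamson1987PhaseCellII, (2.1)–(2.3) p. 1417] -/
theorem sum_bondMult_sub_eq_zero (m : Fin 4 → ℤ) :
    ∑ ν, (bondMult ν m - bondMult ν (m - Pi.single ν 1)) = 0 := by
  set χm : (Fin 4 → ℝ) → ℂ := fun p => cexp (I * ∑ k, (p k : ℂ) * (m k : ℂ)) with hχm
  have hχc : Continuous χm := by rw [hχm]; fun_prop
  -- the shifted character: `e^{ip·(m − e_ν)} = e^{ip·m} e^{−ip_ν}`
  have hshift : ∀ ν (p : Fin 4 → ℝ), cexp (I * ∑ k, (p k : ℂ) * (((m - Pi.single ν 1 : Fin 4 → ℤ) k : ℤ) : ℂ))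
      = χm p * cexp (-I * (p ν : ℂ)) := by
    intro ν p
    rw [hχm]
    dsimp only
    rw [← Complex.exp_add]
    congr 1
    have : ∑ k, (p k : ℂ) * (((m - Pi.single ν 1 : Fin 4 → ℤ) k : ℤ) : ℂ) = ∑ k, (p k : ℂ) * (m k : ℂ) - (p ν : ℂ) := by
      simp only [Pi.sub_apply, Pi.single_apply, Int.cast_sub, Int.cast_ite, Int.cast_one, Int.cast_zero, mul_sub,
        Finset.sum_sub_distrib, mul_ite, mul_one, mul_zero, Finset.sum_ite_eq', Finset.mem_univ, if_true]
    rw [this]; ring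
  -- the weight `e^{ip·m}·(−f_ν(p))` is bounded and continuous
  have hgc : ∀ ν, Continuous fun p : Fin 4 → ℝ => χm p * -f (toC p) ν := fun ν => by
    refine hχc.mul ?_
    unfold f; simp only [toC_apply]; fun_prop
  have hgb : ∀ ν (p : Fin 4 → ℝ), ‖χm p * -f (toC p) ν‖ ≤ 2 := fun ν p => by
    rw [norm_mul, hχm]
    dsimp only
    rw [norm_cexp_pos_phase, one_mul, norm_neg, f, toC_apply]
    refine (norm_sub_le _ _).trans ?_
    rw [show -I * (p ν : ℂ) = ((-p ν : ℝ) : ℂ) * I by push_cast; ring, Complex.norm_exp_ofReal_mul_I, norm_one]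
    norm_num
  have hdiff : ∀ ν, bondMult ν m - bondMult ν (m - Pi.single ν 1)
      = ((((kR : ℝ) : ℂ) * ∫ p in cell, Lam ν (toC p) * (χm p * -f (toC p) ν)).re) := by
    intro ν
    rw [bondMult, bondMult, ← Complex.sub_re, ← mul_sub, ← integral_sub (integrableOn_Lam_toC_mul_cexp ν m)
      (integrableOn_Lam_toC_mul_cexp ν _)]
    congr 2
    refine integral_congr_ae (ae_of_all _ fun p => ?_)
    dsimp only
    rw [hshift ν p, f, toC_apply]
    ring
  simp_rw [hdiff]
  rw [← Complex.re_sum, ← Finset.mul_sum,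
    ← integral_finsetSum _ fun ν _ => integrableOn_Lam_toC_mul ν (hgc ν) (hgb ν)]
  have hzero : ∀ᵐ p : Fin 4 → ℝ, p ∈ cell → ∑ ν, Lam ν (toC p) * (χm p * -f (toC p) ν) = 0 := by
    filter_upwards [ae_off_lattice] with p hp _
    have hf : ∀ μ, f (toC p) μ ≠ 0 := fun μ => f_toC_ne_zero (hp μ)
    have h := sum_Lam_mul_f hf
    calc ∑ ν, Lam ν (toC p) * (χm p * -f (toC p) ν) = -χm p * ∑ ν, Lam ν (toC p) * f (toC p) ν := by
          rw [Finset.mul_sum]; exact Finset.sum_congr rfl fun ν _ => by ring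
      _ = 0 := by rw [h, mul_zero]
  rw [setIntegral_congr_ae measurableSet_cell' hzero]
  simp

end CorrectedMode

end

end Literature.MathematicalPhysics.QuantumFieldTheory.Federbush1986
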